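import Summits.CriticalPhenomena.PercolationContinuityZ3.Theorems.Transplant.FKConnectivityAllQAntipodalAnd4ParallelMain
import HarnessLib

/-!
# Connectivity correlation inequalities for `φ_{w,q}`, every `q > 0` — file 28b: `C_∞(and_S)` FOR THE 3-STAR `S = K₁,₃` ACROSS A PARALLEL
# JUNCTION (the AND functional sees only the vertex partition of `S`, so the star `{ao, ob, oc}` is the path `a–o–b–c` of file 28a)

Support file (`--supports stmt-CriticalPhenomena-4575`), FK sub-lane `prim-bschramm-fk-2` (gen 19) of the post-continuity programme; builds
on p205010 (kernel theorem, internal audit signed; external expert review pending).  No definitions, no named facts, no sorries; standard axioms.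

The AND-drift `∑_{γ ⊆ N} (q^{k(γ∪S)+k(N\γ)} - q^{k((N\γ)∪S)+k(γ)}) g(γ)` depends on the extra edge set `S` only through the partition of its
vertex set into the components of `S` (`k(γ ∪ S) = k(γ ∪ T)` for any `T` with the same components).  Hence the 3-star `S = {ao, ob, oc}` has the
AND-drift of the 3-edge path `{ao, ob, bc}` (`clusterCount_union_star3_eq`), and the parallel-junction theorem of files 28/28a applies with the
junction pair `{o, b}`: root the host graph `H ⊇ S` at `y = ob`; if `H \ ob = A₁ ∥ A₂` is a PARALLEL composition (terminals `o, b`) with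
`x = ao ∈ A₁` and `z = oc ∈ A₂`, then side 1 is literally side 1 of file 28a and side 2 supplies the |W| = 3 drift for `{oc, ob}` (gen 11's
theorem on `A₂`, equal to the drift for `{bc, ob}` by `clusterCount_insert_eq_of_reachable`) and the `ob`-contracted Theorem-U functional with
terminals `o, c` (equal to the one with terminals `b, c`, `apUpcC_contract_terminal_eq`).  Result: **`FK.apPsi_and_star3_parallel_nonpos`** —
`apPsi q H 1_{{ao,ob,oc} ⊆ ·} g ≤ 0` for `0 < q ≤ 1`, `g` increasing and not reading `S`: gen 10's Conjecture `C_∞` at level 3 for the STAR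
with a parallel root (memo `bschramm/FROM-fk-2-g18-AND-WORDHALL.md` §7A: the star junction LP j154649 returned exactly the PAR certificate).
With files 27a/28a: `C_∞(and)` at level 3 holds for `P₄` with series or parallel root and for `K₁,₃` with parallel root; open: the "theta"
junctions (parallel root, two `S`-edges in one series child).
[cite: Grimmett2006, §1.4 eq. (1.20) (p. 15); §3.8 Thm. (3.90) (pp. 61–62); §3.9 (pp. 63–64)] [cite: Wagner2006, Thm. 5.8(d), §5.3]
-/

noncomputable section

namespace Summit.CriticalPhenomena.PercolationContinuityZ3.Theorems

namespace FK

open SimpleGraph Literature.Probability.LatticeModels Literature.Probability.Percolation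
open scoped Classical

variable {V : Type*} [Fintype V]

/-! ### The AND functional sees only the vertex partition of `S` -/

section Partition

variable {o b : V}

omit [Fintype V] in
/-- An open pair joins its ends. [folklore] -/
theorem reachable_of_mem_coe {Z : Finset (Sym2 V)} (h : s(o, b) ∈ Z) (hob : o ≠ b) :
    (openGraph (↑Z : BondConfig V)).Reachable o b :=
  Adj.reachable ((fromEdgeSet_adj _).2 ⟨Finset.mem_coe.2 h, hob⟩)

/-- **Re-hanging an edge along an open path**: if `o ↔ b` in `Z`, then opening `oc` or opening `bc` leaves the same cluster count.
[cite: Grimmett2006, §1.4 eq. (1.20) (p. 15), Thm. (3.1)(a)] -/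
theorem clusterCount_insert_eq_of_reachable {Z : Finset (Sym2 V)} (h : (openGraph (↑Z : BondConfig V)).Reachable o b) (c : V) :
    clusterCount (↑(insert s(o, c) Z) : BondConfig V) ∅ = clusterCount (↑(insert s(b, c) Z) : BondConfig V) ∅ := by
  have i₁ := clusterCount_insert_add_ite Z o c
  have i₂ := clusterCount_insert_add_ite Z b c
  have hiff : (openGraph (↑Z : BondConfig V)).Reachable o c ↔ (openGraph (↑Z : BondConfig V)).Reachable b c :=
    ⟨fun hoc => h.symm.trans hoc, fun hbc => h.trans hbc⟩
  by_cases hr : (openGraph (↑Z : BondConfig V)).Reachable b c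
  · rw [if_pos (hiff.2 hr)] at i₁; rw [if_pos hr] at i₂; omega
  · rw [if_neg (fun h' => hr (hiff.1 h'))] at i₁; rw [if_neg hr] at i₂; omega

omit [Fintype V] in
/-- Moving a terminal along an open pair does not change the connection indicator. [folklore] -/
theorem apConn_eq_of_reachable {Z : Finset (Sym2 V)} (h : (openGraph (↑Z : BondConfig V)).Reachable o b) (c : V) :
    apConn Z o c = apConn Z b c := by
  unfold apConn
  have hiff : (openGraph (↑Z : BondConfig V)).Reachable o c ↔ (openGraph (↑Z : BondConfig V)).Reachable b c :=
    ⟨fun hoc => h.symm.trans hoc, fun hbc => h.trans hbc⟩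
  by_cases hr : (openGraph (↑Z : BondConfig V)).Reachable b c
  · rw [if_pos (hiff.2 hr), if_pos hr]
  · rw [if_neg (fun h' => hr (hiff.1 h')), if_neg hr]

omit [Fintype V] in
/-- `X ∪ {x, y, z}` as an insertion on top of `X ∪ {x, y}`. [folklore] -/
theorem union_triple_eq_insert (X : Finset (Sym2 V)) (x y z : Sym2 V) : X ∪ {x, y, z} = insert z (X ∪ {x, y}) := by
  ext e
  simp only [Finset.mem_union, Finset.mem_insert, Finset.mem_singleton]
  tauto

/-- **Star = path for the AND functional**: `k(X ∪ {ao, ob, oc}) = k(X ∪ {ao, ob, bc})` (`o ≠ b`). [cite: Grimmett2006, §1.4 eq. (1.20) (p. 15)] -/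
theorem clusterCount_union_star3_eq (X : Finset (Sym2 V)) (a c : V) (hob : o ≠ b) :
    clusterCount (↑(X ∪ {s(a, o), s(o, b), s(o, c)}) : BondConfig V) ∅ =
      clusterCount (↑(X ∪ {s(a, o), s(o, b), s(b, c)}) : BondConfig V) ∅ := by
  rw [union_triple_eq_insert, union_triple_eq_insert]
  refine clusterCount_insert_eq_of_reachable (reachable_of_mem_coe ?_ hob) c
  simp only [Finset.mem_union, Finset.mem_insert, Finset.mem_singleton, or_true]

/-- The |W| = 3 atom of side 2: `k(Y ∪ {bc, ob}) = k(Y ∪ {oc, ob})` (`o ≠ b`). [cite: Grimmett2006, §1.4 eq. (1.20) (p. 15)] -/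
theorem clusterCount_insert_insert_hub_eq (Y : Finset (Sym2 V)) (c : V) (hob : o ≠ b) :
    clusterCount (↑(insert s(o, b) (insert s(b, c) Y)) : BondConfig V) ∅ =
      clusterCount (↑(insert s(o, b) (insert s(o, c) Y)) : BondConfig V) ∅ := by
  rw [Finset.insert_comm s(o, b) s(b, c), Finset.insert_comm s(o, b) s(o, c)]
  exact (clusterCount_insert_eq_of_reachable (reachable_of_mem_coe (Finset.mem_insert_self _ _) hob) c).symm

omit [Fintype V] in
/-- **Contracted terminal**: with `ob` contracted, the terminals `o, c` and `b, c` give the same functional. [folklore] -/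
theorem apUpcC_contract_terminal_eq (q : ℝ) (N : Finset (Sym2 V)) (c : V) (hob : o ≠ b) (h : Finset (Sym2 V) → ℝ) :
    apUpcC q N {s(o, b)} o c h = apUpcC q N {s(o, b)} b c h := by
  unfold apUpcC
  refine Finset.sum_congr rfl fun γ _ => ?_
  have m₁ : s(o, b) ∈ γ ∪ {s(o, b)} := Finset.mem_union_right _ (Finset.mem_singleton_self _)
  have m₂ : s(o, b) ∈ N \ γ ∪ {s(o, b)} := Finset.mem_union_right _ (Finset.mem_singleton_self _)
  rw [apConn_eq_of_reachable (reachable_of_mem_coe m₁ hob) c, apConn_eq_of_reachable (reachable_of_mem_coe m₂ hob) c]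

omit [Fintype V] in
/-- The AND configuration of the star junction: `(X ∪ Y) ∪ {ao, ob, oc} = (X ∪ {ao}) ∪ (Y ∪ {oc}) ∪ {ob}` as finsets. [folklore] -/
theorem union_star3_eq (X Y : Finset (Sym2 V)) (a c : V) :
    X ∪ Y ∪ {s(a, o), s(o, b), s(o, c)} = insert s(o, b) (insert s(a, o) X ∪ insert s(o, c) Y) := by
  ext e
  simp only [Finset.mem_union, Finset.mem_insert, Finset.mem_singleton]
  tauto

end Partition

/-! ### `C_∞(and_S)` for the 3-star across a parallel junction -/

section Main

variable {o a b c : V}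

/-- **THEOREM (`C_∞` at level 3 for `S = K₁,₃`, parallel junction).**  Let `A₁ = N₁ ∪ {ao}` and `A₂ = N₂ ∪ {oc}` be two-terminal
series–parallel networks between `o` and `b`, edge-disjoint, with spanned vertex sets meeting only inside `{o, b}`, neither containing `ob`.
Then for `H = A₁ ∪ A₂ ∪ {ob}` — a 2-connected series–parallel graph whose `H \ ob` is the PARALLEL composition `A₁ ∥ A₂` with the star
edges `ao`, `oc` in different children — the star `S = {ao, ob, oc} ⊆ H` (centre `o`), every `0 < q ≤ 1` and every increasing `g` not
reading `S`: `apPsi q H 1_{S ⊆ ·} g ≤ 0`, i.e. every square-free coefficient of `Z_H² Cov_{φ_{z,q}}(ω_{ao} ω_{ob} ω_{oc}, g)` is `≤ 0` —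
gen 10's Conjecture `C_∞` for the AND type on a 3-star, parallel case.  Proof: the AND-drift of the star is that of the path `a–o–b–c`
(`clusterCount_union_star3_eq`); then `and4_parallel_nonpos` with junction pair `{o, b}`, side inputs `and2_side_nonpos` / `xi_side_nonneg`
on `A₁` verbatim and on `A₂` after `clusterCount_insert_insert_hub_eq` / `apUpcC_contract_terminal_eq`.
[cite: Grimmett2006, §3.8 Thm. (3.90) (pp. 61–62); §3.9 (pp. 63–64)] [cite: Wagner2006, Thm. 5.8(d), §5.3] -/
theorem apPsi_and_star3_parallel_nonpos {q : ℝ} (hq0 : 0 < q) (hq1 : q ≤ 1) {N₁ N₂ : Finset (Sym2 V)}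
    (hA₁ : IsTTSP (insert s(a, o) N₁) o b) (hA₂ : IsTTSP (insert s(o, c) N₂) o b) (haoN : s(a, o) ∉ N₁) (hocN : s(o, c) ∉ N₂)
    (hd : Disjoint (insert s(a, o) N₁) (insert s(o, c) N₂))
    (hV : ∀ z : V, (∃ e ∈ insert s(a, o) N₁, z ∈ e) → (∃ e ∈ insert s(o, c) N₂, z ∈ e) → z = o ∨ z = b)
    (hob₁ : s(o, b) ∉ insert s(a, o) N₁) (hob₂ : s(o, b) ∉ insert s(o, c) N₂)
    {g : Finset (Sym2 V) → ℝ} (hg : ∀ A T : Finset (Sym2 V), T ⊆ {s(a, o), s(o, b), s(o, c)} → g (A ∪ T) = g A)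
    (hmono : ∀ ⦃A B : Finset (Sym2 V)⦄, A ⊆ B → B ⊆ N₁ ∪ N₂ → g A ≤ g B) :
    apPsi q (insert s(o, b) (insert s(a, o) N₁ ∪ insert s(o, c) N₂))
      (fun X => if ({s(a, o), s(o, b), s(o, c)} : Finset (Sym2 V)) ⊆ X then 1 else 0) g ≤ 0 := by
  have hob : o ≠ b := hA₁.ne
  -- vertex sets of the sides (side 2 enlarged by the virtual end edge `bc` of the path `a–o–b–c`)
  set E₂ : Finset (Sym2 V) := insert s(b, c) (insert s(o, c) N₂) with hE₂
  set V₁ : Set V := {z | ∃ e ∈ insert s(a, o) N₁, z ∈ e} with hV₁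
  set V₂ : Set V := {z | ∃ e ∈ E₂, z ∈ e} with hV₂
  have h₁ : ∀ e ∈ (↑(insert s(a, o) N₁) : Set (Sym2 V)), ∀ z ∈ e, z ∈ V₁ := fun e he z hz => ⟨e, he, hz⟩
  have h₂ : ∀ e ∈ (↑E₂ : Set (Sym2 V)), ∀ z ∈ e, z ∈ V₂ := fun e he z hz => ⟨e, he, hz⟩
  have hcV : c ∈ ({z | ∃ e ∈ insert s(o, c) N₂, z ∈ e} : Set V) := ⟨s(o, c), Finset.mem_insert_self _ _, Sym2.mem_mk_right o c⟩
  have hS : V₁ ∩ V₂ ⊆ ({o, b} : Set V) := by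
    rintro z ⟨hz₁, ⟨e, he, hze⟩⟩
    rcases Finset.mem_insert.1 he with rfl | he
    · -- `z` lies on the virtual edge `bc`
      rcases Sym2.mem_iff.1 hze with rfl | rfl
      · exact Or.inr rfl
      · rcases hV _ hz₁ hcV with h | h
        · exact Or.inl h
        · exact Or.inr h
    · rcases hV z hz₁ ⟨e, he, hze⟩ with h | h
      · exact Or.inl h
      · exact Or.inr h
  have hdN : Disjoint N₁ N₂ :=
    Finset.disjoint_of_subset_left (Finset.subset_insert _ _) (Finset.disjoint_of_subset_right (Finset.subset_insert _ _) hd)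
  have hN₂ : N₂ ⊆ E₂ := (Finset.subset_insert _ _).trans (Finset.subset_insert _ _)
  -- `S` is disjoint from `N = N₁ ⊔ N₂`
  have hNS : Disjoint (N₁ ∪ N₂) ({s(a, o), s(o, b), s(o, c)} : Finset (Sym2 V)) := by
    refine Finset.disjoint_left.2 fun e he heS => ?_
    simp only [Finset.mem_insert, Finset.mem_singleton] at heS
    rcases Finset.mem_union.1 he with h | h
    · rcases heS with rfl | rfl | rfl
      · exact haoN h
      · exact hob₁ (Finset.mem_insert_of_mem h)
      · exact Finset.disjoint_left.1 hd (Finset.mem_insert_of_mem h) (Finset.mem_insert_self _ _)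
    · rcases heS with rfl | rfl | rfl
      · exact Finset.disjoint_left.1 hd (Finset.mem_insert_self _ _) (Finset.mem_insert_of_mem h)
      · exact hob₂ (Finset.mem_insert_of_mem h)
      · exact hocN h
  rw [← union_star3_eq N₁ N₂ a c, apPsi_andInd_eq q hNS ⟨s(a, o), Finset.mem_insert_self _ _⟩ hg]
  -- the star drift is the path drift
  have conv : ∑ γ ∈ (N₁ ∪ N₂).powerset,
      (q ^ (clusterCount (↑(γ ∪ {s(a, o), s(o, b), s(o, c)}) : BondConfig V) ∅ + clusterCount (↑((N₁ ∪ N₂) \ γ) : BondConfig V) ∅) -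
        q ^ (clusterCount (↑((N₁ ∪ N₂) \ γ ∪ {s(a, o), s(o, b), s(o, c)}) : BondConfig V) ∅ + clusterCount (↑γ : BondConfig V) ∅)) * g γ =
      ∑ γ ∈ (N₁ ∪ N₂).powerset,
      (q ^ (clusterCount (↑(γ ∪ {s(a, o), s(o, b), s(b, c)}) : BondConfig V) ∅ + clusterCount (↑((N₁ ∪ N₂) \ γ) : BondConfig V) ∅) -
        q ^ (clusterCount (↑((N₁ ∪ N₂) \ γ ∪ {s(a, o), s(o, b), s(b, c)}) : BondConfig V) ∅ + clusterCount (↑γ : BondConfig V) ∅)) * g γ := by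
    refine Finset.sum_congr rfl fun γ _ => ?_
    rw [clusterCount_union_star3_eq γ a c hob, clusterCount_union_star3_eq ((N₁ ∪ N₂) \ γ) a c hob]
  rw [conv]
  -- the four side inputs, in the shape of `and4_parallel_nonpos` for the path `a–o–b–c` with junction pair `{o, b}`
  have hY₁ : ∀ h' : Finset (Sym2 V) → ℝ, (∀ ⦃A B : Finset (Sym2 V)⦄, A ⊆ B → B ⊆ N₁ → h' A ≤ h' B) →
      ∑ γ₁ ∈ N₁.powerset, (q ^ (clusterCount (↑(insert s(o, b) (insert s(a, o) γ₁)) : BondConfig V) ∅ +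
          clusterCount (↑(N₁ \ γ₁) : BondConfig V) ∅) -
        q ^ (clusterCount (↑(insert s(o, b) (insert s(a, o) (N₁ \ γ₁))) : BondConfig V) ∅ +
          clusterCount (↑γ₁ : BondConfig V) ∅)) * h' γ₁ ≤ 0 := by
    intro h' hm
    have key := and2_side_nonpos hq0 hq1 hA₁ hob₁ (Finset.mem_insert_self _ _) (h := h')
      (by rw [Finset.erase_insert haoN]; exact hm)
    rwa [Finset.erase_insert haoN] at key
  have hΞ₁ : ∀ h' : Finset (Sym2 V) → ℝ, (∀ ⦃A B : Finset (Sym2 V)⦄, A ⊆ B → B ⊆ N₁ → h' A ≤ h' B) →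
      0 ≤ apUpcC q N₁ {s(o, b)} a o h' := by
    intro h' hm
    have key := xi_side_nonneg hq0 hA₁ hob₁ (Finset.mem_insert_self _ _) (h := h')
      (by rw [Finset.erase_insert haoN]; exact hm)
    rwa [Finset.erase_insert haoN] at key
  have hY₂ : ∀ h' : Finset (Sym2 V) → ℝ, (∀ ⦃A B : Finset (Sym2 V)⦄, A ⊆ B → B ⊆ N₂ → h' A ≤ h' B) →
      ∑ γ₂ ∈ N₂.powerset, (q ^ (clusterCount (↑(insert s(o, b) (insert s(b, c) γ₂)) : BondConfig V) ∅ +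
          clusterCount (↑(N₂ \ γ₂) : BondConfig V) ∅) -
        q ^ (clusterCount (↑(insert s(o, b) (insert s(b, c) (N₂ \ γ₂))) : BondConfig V) ∅ +
          clusterCount (↑γ₂ : BondConfig V) ∅)) * h' γ₂ ≤ 0 := by
    intro h' hm
    have key := and2_side_nonpos hq0 hq1 hA₂ hob₂ (Finset.mem_insert_self _ _) (h := h')
      (by rw [Finset.erase_insert hocN]; exact hm)
    rw [Finset.erase_insert hocN] at key
    have hsum : ∑ γ₂ ∈ N₂.powerset, (q ^ (clusterCount (↑(insert s(o, b) (insert s(b, c) γ₂)) : BondConfig V) ∅ +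
          clusterCount (↑(N₂ \ γ₂) : BondConfig V) ∅) -
        q ^ (clusterCount (↑(insert s(o, b) (insert s(b, c) (N₂ \ γ₂))) : BondConfig V) ∅ +
          clusterCount (↑γ₂ : BondConfig V) ∅)) * h' γ₂ =
        ∑ γ₂ ∈ N₂.powerset, (q ^ (clusterCount (↑(insert s(o, b) (insert s(o, c) γ₂)) : BondConfig V) ∅ +
          clusterCount (↑(N₂ \ γ₂) : BondConfig V) ∅) -
        q ^ (clusterCount (↑(insert s(o, b) (insert s(o, c) (N₂ \ γ₂))) : BondConfig V) ∅ +
          clusterCount (↑γ₂ : BondConfig V) ∅)) * h' γ₂ := by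
      refine Finset.sum_congr rfl fun γ₂ _ => ?_
      rw [clusterCount_insert_insert_hub_eq γ₂ c hob, clusterCount_insert_insert_hub_eq (N₂ \ γ₂) c hob]
    rw [hsum]; exact key
  have hΞ₂ : ∀ h' : Finset (Sym2 V) → ℝ, (∀ ⦃A B : Finset (Sym2 V)⦄, A ⊆ B → B ⊆ N₂ → h' A ≤ h' B) →
      0 ≤ apUpcC q N₂ {s(o, b)} b c h' := by
    intro h' hm
    have key := xi_side_nonneg hq0 hA₂ hob₂ (Finset.mem_insert_self _ _) (h := h')
      (by rw [Finset.erase_insert hocN]; exact hm)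
    rw [Finset.erase_insert hocN, apUpcC_contract_terminal_eq q N₂ c hob h'] at key
    exact key
  have main := and4_parallel_nonpos hq0 hq1 h₁ h₂ hS hob (Finset.mem_insert_self _ _) (Finset.mem_insert_self _ _)
    hdN (Finset.subset_insert _ _) hN₂ hY₁ hΞ₁ hY₂ hΞ₂ hmono
  linarith

end Main

end FK

end Summit.CriticalPhenomena.PercolationContinuityZ3.Theorems

end
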